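import Summits.CriticalPhenomena.PercolationContinuityZ3.Theorems.PercNearOneGluingNoHeavyLowerTailMixCSHTheoremOne
import Literature.Probability.Percolation.KozmaNitzanGoodQuadruple
import HarnessLib

/-!
# Kozma–Nitzan's Question 9 exactly as printed: every relay set, observer inside or outside `A`

Support file (`--supports stmt-CriticalPhenomena-4575`), cell perc-kn (req609-KN), lead `perc-kn-lead` (gen 4).  No definitions,
no named facts, no sorries; standard axioms.  Requested by the cell's five independent faithfulness audits (`AUDIT-r2-g2…g6.md`,
note N1): the tree's all-weights name `MixCSH.kn_question9` carries the hypothesis `hoA : o ∉ A`, which the printed question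
(arXiv:2401.12397, §5.5 p. 36: "Let G, A, 0 and b be as above. Let H be the graph given from G by removing all edges going out
of 0. Let a be the point minimising P_H(a ↔ b) among the points of A. Is it true that in this case (41) holds?") does not have.

`MixCSH.kn_question9_print` removes it.  The extra case `o ∈ A` is degenerate: `{o ↔ A}` is then the sure event, and in
`H = G − E(o)` (`restrW {o}ᶜ w`) the observer is isolated, so `P_H(o ↔ b) = 0` for `b ≠ o` and the `H`-minimiser `c` has
`P_H(c ↔ b) = 0`, i.e. almost surely every open `c–b` path visits `o`; hence `P(c ↔ b) ≤ P(o ↔ b)` by the pointwise inclusion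
`{c ↔ b} ⊆ {o ↔ b} ∪ {c ↔ b off o}` and a union bound.  The case `o ∉ A` is `MixCSH.kn_question9` verbatim.
[cite: KozmaNitzan2024, Question 9 (§5.5 p. 36), display (41) (p. 36)]
-/

noncomputable section

namespace Summit.CriticalPhenomena.PercolationContinuityZ3.Theorems

open MeasureTheory Set
open Literature.Probability.LatticeModels (prodBernoulli)
open Literature.Probability.Percolation
open scoped Classical

namespace MixCSH

/-- In `H = G − E(o)` (weights restricted to `{o}ᶜ`) the observer `o` is isolated: `P_H(o ↔ b) = 0` for `b ≠ o`.
[cite: KozmaNitzan2024, Question 9 (§5.5 p. 36): "the graph given from G by removing all edges going out of 0"] -/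
theorem restrW_compl_real_openConn_self {W : Type*} [Fintype W] (w : Sym2 W → unitInterval) {o b : W} (hbo : b ≠ o) :
    (prodBernoulli (restrW ({o}ᶜ : Set W) w)).real (openConn o b) = 0 := by
  rw [KNGoodAux.restrW_real_eq]
  have h0 : {ω : BondConfig W | ω ∩ wireSet ({o}ᶜ : Set W) ∈ (openConn o b : Set (BondConfig W))} = ∅ := by
    ext ω
    simp only [mem_setOf_eq, mem_empty_iff_false, iff_false]
    intro h
    change (openGraph (ω ∩ wireSet ({o}ᶜ : Set W))).Reachable o b at h
    rw [SimpleGraph.reachable_iff_reflTransGen] at h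
    rcases Relation.ReflTransGen.cases_head h with hob | ⟨c, hc, -⟩
    · exact hbo hob.symm
    · obtain ⟨⟨-, hwire⟩, -⟩ := (openGraph_adj _ _ _).1 hc
      exact (mem_compl_singleton_iff.1 (mk_mem_wireSet_iff.1 hwire).1) rfl
  rw [h0, measureReal_empty]

/-- Pointwise splitting of `{a ↔ b}`: an open `a–b` path either avoids `o` (then `a ↔ b` off `o`) or, if some vertex reachable
from `a` is `o`, then `o ↔ b`. [cite: KozmaNitzan2024, Question 9 (§5.5 p. 36)] -/
theorem openConn_subset_openConn_union_openConnIn_compl {W : Type*} (o a b : W) :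
    (openConn a b : Set (BondConfig W)) ⊆ openConn o b ∪ openConnIn ({o}ᶜ : Set W) a b := by
  intro ω hω
  by_cases h : ω ∈ openConnIn ({o}ᶜ : Set W) a b
  · exact Or.inr h
  · left
    by_contra hno
    apply h
    refine KNGoodAux.openConnIn_of_reachable_of_forall_mem hω fun y hy => ?_
    rw [mem_compl_singleton_iff]
    rintro rfl
    exact hno (hy.symm.trans hω)

/-- **KOZMA–NITZAN'S QUESTION 9 EXACTLY AS PRINTED** (arXiv:2401.12397 §5.5, p. 36) — every finite vertex type, every weight
function in `[0,1]`, every relay set `A` (the observer `o` may lie in `A`), every target `b`, and EVERY `c ∈ A` minimising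
`P_H(· ↔ b)` over `A` in the relay graph `H = G − E(o)` (`restrW {o}ᶜ w`):  `P(c ↔ b, o ↔ A) ≤ P(o ↔ b, o ↔ A)`, i.e. (41) holds.
For `o ∉ A` this is `MixCSH.kn_question9`; for `o ∈ A` the event `{o ↔ A}` is sure and the `H`-minimiser has `P_H(c ↔ b) = 0`
(`restrW_compl_real_openConn_self`), whence `P(c ↔ b) ≤ P(o ↔ b)` by `openConn_subset_openConn_union_openConnIn_compl`,
`KNGoodAux.restrW_real_openConn` and a union bound. [cite: KozmaNitzan2024, Question 9 (§5.5 p. 36), display (41) (p. 36)] -/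
theorem kn_question9_print {W : Type*} [Fintype W] (w : Sym2 W → unitInterval) (o : W) (A : Finset W) (b c : W) (hcA : c ∈ A)
    (hmin : ∀ a ∈ A, (prodBernoulli (restrW ({o}ᶜ : Set W) w)).real (openConn c b) ≤
      (prodBernoulli (restrW ({o}ᶜ : Set W) w)).real (openConn a b)) :
    (prodBernoulli w).real (openConn c b ∩ ⋃ a ∈ A, openConn o a) ≤
      (prodBernoulli w).real (openConn o b ∩ ⋃ a ∈ A, openConn o a) := by
  by_cases hoA : o ∈ A
  swap
  · exact kn_question9 w o A hoA b c hcA hmin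
  have hU : (⋃ a ∈ A, openConn o a : Set (BondConfig W)) = univ :=
    eq_univ_of_forall fun ω => mem_biUnion hoA (SimpleGraph.Reachable.refl o)
  rw [hU, inter_univ, inter_univ]
  by_cases hco : c = o
  · subst hco
    exact le_rfl
  by_cases hbo : b = o
  · subst hbo
    have h1 : (openConn b b : Set (BondConfig W)) = univ := eq_univ_of_forall fun ω => SimpleGraph.Reachable.refl b
    rw [h1]
    exact measureReal_mono (subset_univ _) (measure_ne_top _ _)
  have hHc : (prodBernoulli (restrW ({o}ᶜ : Set W) w)).real (openConn c b) = 0 :=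
    le_antisymm ((hmin o hoA).trans (restrW_compl_real_openConn_self w hbo).le) measureReal_nonneg
  rw [KNGoodAux.restrW_real_openConn w o hco b] at hHc
  calc (prodBernoulli w).real (openConn c b)
      ≤ (prodBernoulli w).real (openConn o b ∪ openConnIn ({o}ᶜ : Set W) c b) :=
        measureReal_mono (openConn_subset_openConn_union_openConnIn_compl o c b) (measure_ne_top _ _)
    _ ≤ (prodBernoulli w).real (openConn o b) + (prodBernoulli w).real (openConnIn ({o}ᶜ : Set W) c b) :=
        measureReal_union_le _ _
    _ = (prodBernoulli w).real (openConn o b) := by rw [hHc, add_zero]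

/-- Printed Question 9 in the relay-set-first intersection order `P(o ↔ A, c ↔ b) ≤ P(o ↔ b, o ↔ A)` used by the tree's sockets
(`MixCSH.kn_question9_socket` shape without `o ∉ A`). [cite: KozmaNitzan2024, Question 9 (§5.5 p. 36)] -/
theorem kn_question9_print' {W : Type*} [Fintype W] (w : Sym2 W → unitInterval) (A : Finset W) (o b c : W) (hcA : c ∈ A)
    (hmin : ∀ a ∈ A, (prodBernoulli (restrW ({o}ᶜ : Set W) w)).real (openConn c b) ≤
      (prodBernoulli (restrW ({o}ᶜ : Set W) w)).real (openConn a b)) :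
    (prodBernoulli w).real ((⋃ a ∈ A, openConn o a) ∩ openConn c b) ≤
      (prodBernoulli w).real (openConn o b ∩ ⋃ a ∈ A, openConn o a) := by
  rw [inter_comm]
  exact kn_question9_print w o A b c hcA hmin

/-- Non-vacuity / consistency check: the tree's `MixCSH.kn_question9` (observer outside `A`) is the special case `o ∉ A`. -/
example {W : Type*} [Fintype W] (w : Sym2 W → unitInterval) (o : W) (A : Finset W) (_hoA : o ∉ A) (b c : W) (hcA : c ∈ A)
    (hmin : ∀ a ∈ A, (prodBernoulli (restrW ({o}ᶜ : Set W) w)).real (openConn c b) ≤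
      (prodBernoulli (restrW ({o}ᶜ : Set W) w)).real (openConn a b)) :
    (prodBernoulli w).real (openConn c b ∩ ⋃ a ∈ A, openConn o a) ≤
      (prodBernoulli w).real (openConn o b ∩ ⋃ a ∈ A, openConn o a) :=
  kn_question9_print w o A b c hcA hmin

end MixCSH

end Summit.CriticalPhenomena.PercolationContinuityZ3.Theorems

end
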